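import Summits.QuantumFields.YangMills.Theorems.SwapVirialDeficitBlowUpScaling
import HarnessLib

/-!
# THE SCALING IDENTITY FOR INTEGRANDS at every scale (brick V1 of the «fixed L → window» programme; sequel of ✓`…BlowUpScaling`):
# `∫ G dμ_L = coneConst^{6L⁴} · t^{18L⁴−2} · ∫_B 𝟙_{S_t} · G(history of blowUpPoint t x) dβ(x)` for EVERY `t > 0` and every invariant integrand `G`
# (free-hands support of ⟨stmt-QuantumFields-24197⟩ `SwapVirialDeficit.SwapGluedStiffness`)

✓`BlowUpRing.ringMeasure_swapDeficit_le_eq_blowUp` is (S) for the INDICATOR of a sublevel set of `F^S_z`.  The same three charts transport ANY measurable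
`G ≥ 0` on ring histories that is invariant under a re-indexed seam action `(U⃗, g) ↦ (h·U⃗, h·g·(h∘κ)⁻¹)` (any site map `κ`; `F^S_z`, `e^{−bF^S_z}`, the periodic
deficit with `κ = id`, products of such):

* §1 `history_conj_of_seamGaugeAct` — constant `h ≡ k` is simultaneous conjugation of the history; ★ `chart_conj` — in chart coordinates it is simultaneous
  conjugation of `(C, U)` (✓`ringConfig_conj`, central `χ`); ★ `lintegral_pi_chart_conj` — so the inner follower integral `C ↦ ∫ G(hist(C, U)) dHaar^{Fol}(U)` is a
  CLASS FUNCTION of the leaders (the hypothesis of the leader chart ✓`lintegral_haar_four_eq_leaderChart`);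
* §2 ★ `lintegral_pi_chart_eq_followerChart` — the inner integral through ✓`lintegral_haar_pi_eq_followerChart` (centres `≡ 1`);
* §3 ★★★ `lintegral_ringMeasure_eq_blowUp` — for central `χ`, every `t > 0`:
  `∫⁻ G ∂μ_L = ofReal(coneConst^{6L⁴}·t^{18L⁴−2}) · ∫⁻ x, 𝟙{dil3 t w ∈ ball3 ∧ ∀ i, ‖dilateIm t (y i)‖ < 1}·G (fixHistory (ringConfig χ (blowUpPoint t x))) ∂β`,
  `β = cone ⊗ (vol³ ⊗ vol^{Fol})` — the indicator case `G = 𝟙{F^S_z ≤ s}` is ✓`ringMeasure_swapDeficit_le_eq_blowUp`;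
(Integrands that are functions OF THE DEFICIT, `G = H ∘ F^S_z` — sublevel indicators, `e^{−bF^S_z}` — are fcl-p3 g45's ✓`…BlowUpLaplaceChart`
(`lintegral_comp_swapDeficit_eq_blowUp`, `laplace_swapDeficit_eq_blowUp`); this file is the version for ARBITRARY invariant integrands, e.g. `ψ(history)·e^{−bF}`
with a gauge-invariant cut-off `ψ` that is not a function of `F`.)

HONEST LABEL: exact change-of-variables bookkeeping (plumbing of a DRAFT line); no estimate, no window-uniform statement; ⟨24197⟩ ∕ ⟨24194⟩ ∕ ⟨24497⟩ OPEN;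
own crux ⟨22884⟩ OPEN (blocked-on ⟨19935⟩); no crux, rung of record or summit is proved; the Yang–Mills mass gap is NOT proved; no summit is proved by a line.
THEOREMS ONLY (0 `def`, 0 `sorry`), standard axioms; the series' local `ℍ` instances.  Width seat ym-line-sfw-p2-w2 g57 (cell ym-idea-1, free hands),
`--supports stmt-QuantumFields-24197`.  References: [cite: tHooft1979]; [cite: Luscher1983, §2]; [cite: SeilerLNP1982, §2]; [folklore].
-/

set_option autoImplicit false

noncomputable section

open MeasureTheory Quaternion Set
open scoped Quaternion ENNReal BigOperators
open Literature.MathematicalPhysics.QuantumLattice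
open Literature.MathematicalPhysics.QuantumFieldTheory hiding SU2
open Summit.QuantumFields.YangMills.Theorems.SwapTwistDeficit.ToronLog

attribute [local instance] Literature.Analysis.FluidPDE.Tao2016.quatMeasurableSpace
  Literature.Analysis.FluidPDE.Tao2016.quatBorelSpace
  Literature.MathematicalPhysics.QuantumLattice.secondCountableTopology_su2

namespace Summit.QuantumFields.YangMills.Theorems.SwapVirialDeficit.BlowUpRing

open Summit.QuantumFields.YangMills.Theorems.FemtoTransferGap
open Summit.QuantumFields.YangMills.Theorems.FemtoTransferGap.TT
open Summit.QuantumFields.YangMills.Theorems.VirialFluxGap.RingDeficit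
open Summit.QuantumFields.YangMills.Theorems.SwapVirialDeficit.SwapRing
open Summit.QuantumFields.YangMills.Theorems.SwapVirialDeficit.ZeroModeSigma (dil3 measurable_dil3 ball3 measurableSet_ball3 dilateIm continuous_dilateIm)
open Summit.QuantumFields.YangMills.Theorems.SwapVirialDeficit.BlowUp (leaderTuple measurable_leaderTuple lintegral_haar_four_eq_leaderChart
  lintegral_haar_pi_eq_followerChart)

variable {L : ℕ} [NeZero L]

/-! ## §1 Invariance: constant gauge transformations are simultaneous conjugations, on histories and in the chart -/

omit [NeZero L] in
/-- A CONSTANT re-indexed seam action is simultaneous conjugation of the history: `(k·U⃗, k·g·(k∘κ)⁻¹) = (U⃗^{k}, k g k⁻¹)`. [folklore] -/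
theorem seamGaugeAct_const (κ : Site 3 L → Site 3 L) (k : SU2) (p : (Fin (2 * L - 1 + 1) → GaugeConfig 3 L SU2) × (Site 3 L → SU2)) :
    ((fun i => gaugeTransform (fun _ : Site 3 L => k) (p.1 i)), (fun _ : Site 3 L => k) * p.2 * ((fun _ : Site 3 L => k) ∘ κ)⁻¹) =
      (((fun i => gaugeTransform (fun _ : Site 3 L => k) (p.1 i)), (fun x => k * p.2 x * k⁻¹)) :
        (Fin (2 * L - 1 + 1) → GaugeConfig 3 L SU2) × (Site 3 L → SU2)) := by
  refine Prod.ext rfl ?_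
  funext x
  simp only [Pi.mul_apply, Pi.inv_apply, Function.comp_apply]

/-- ★ **In chart coordinates the constant gauge transformation `k` is simultaneous conjugation of `(C, U)`** (central `χ`): for any `G` on histories invariant under
a re-indexed seam action, `G (hist (kCk⁻¹, kUk⁻¹)) = G (hist (C, U))`. [folklore] -/
theorem chart_conj {α : Type*} (κ : Site 3 L → Site 3 L) {χ : Site 3 L → SU2} (hχ : ∀ (x : Site 3 L) (k : SU2), k * χ x = χ x * k)
    {G : (Fin (2 * L - 1 + 1) → GaugeConfig 3 L SU2) × (Site 3 L → SU2) → α}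
    (hinv : ∀ (h : Site 3 L → SU2) (p : (Fin (2 * L - 1 + 1) → GaugeConfig 3 L SU2) × (Site 3 L → SU2)),
      G ((fun i => gaugeTransform h (p.1 i)), h * p.2 * (h ∘ κ)⁻¹) = G p)
    (k : SU2) (q : (Fin 4 → SU2) × (Fol L → SU2)) :
    G (fixHistory (ringConfig χ ((fun m => k * q.1 m * k⁻¹), (fun i => k * q.2 i * k⁻¹)))) = G (fixHistory (ringConfig χ q)) := by
  unfold fixHistory
  rw [ringConfig_conj hχ k q]
  have h := hinv (fun _ : Site 3 L => k) (fixHistory (ringConfig χ q))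
  rw [seamGaugeAct_const] at h
  unfold fixHistory at h
  refine Eq.trans ?_ h
  congr 1
  refine Prod.ext ?_ rfl
  funext i
  refine Fin.cases ?_ (fun j => ?_) i
  · simp only [Fin.cons_zero, glue_conj']
  · simp only [Fin.cons_succ]

/-- ★ **THE INNER FOLLOWER INTEGRAL IS A CLASS FUNCTION OF THE LEADERS** for any invariant integrand (central `χ`):
`∫ G(hist (kCk⁻¹, U)) dHaar^{Fol}(U) = ∫ G(hist (C, U)) dHaar^{Fol}(U)` (`U ↦ k⁻¹Uk` preserves `Haar^{Fol}`). [cite: tHooft1979] -/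
theorem lintegral_pi_chart_conj (κ : Site 3 L → Site 3 L) {χ : Site 3 L → SU2} (hχ : ∀ (x : Site 3 L) (k : SU2), k * χ x = χ x * k)
    {G : (Fin (2 * L - 1 + 1) → GaugeConfig 3 L SU2) × (Site 3 L → SU2) → ℝ≥0∞} (hG : Measurable G)
    (hinv : ∀ (h : Site 3 L → SU2) (p : (Fin (2 * L - 1 + 1) → GaugeConfig 3 L SU2) × (Site 3 L → SU2)),
      G ((fun i => gaugeTransform h (p.1 i)), h * p.2 * (h ∘ κ)⁻¹) = G p)
    (k : SU2) (C : Fin 4 → SU2) :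
    ∫⁻ U, G (fixHistory (ringConfig χ ((fun m => k * C m * k⁻¹), U))) ∂(Measure.pi fun _ : Fol L => haarProbability SU2) =
      ∫⁻ U, G (fixHistory (ringConfig χ (C, U))) ∂(Measure.pi fun _ : Fol L => haarProbability SU2) := by
  have hGC : Measurable fun U : Fol L → SU2 => G (fixHistory (ringConfig χ (C, U))) :=
    hG.comp (measurable_fixHistory.comp ((measurable_ringConfig χ).comp (measurable_const.prodMk measurable_id)))
  have h := (measurePreserving_conj_fol (L := L) k⁻¹).lintegral_comp hGC
  refine Eq.trans (lintegral_congr fun U => ?_) h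
  have e := chart_conj κ hχ hinv k⁻¹ ((fun m => k * C m * k⁻¹), U)
  have hC : (fun m => k⁻¹ * (k * C m * k⁻¹) * k⁻¹⁻¹) = C := by funext m; group
  simp only [hC] at e
  exact e.symm

/-! ## §2 The inner integral through the follower chart -/

/-- ★ **The inner follower integral through the follower chart** (centres `≡ 1`), for every `t > 0`. [folklore] -/
theorem lintegral_pi_chart_eq_followerChart (χ : Site 3 L → SU2) {G : (Fin (2 * L - 1 + 1) → GaugeConfig 3 L SU2) × (Site 3 L → SU2) → ℝ≥0∞}
    (hG : Measurable G) (C : Fin 4 → SU2) {t : ℝ} (ht : 0 < t) :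
    ∫⁻ U, G (fixHistory (ringConfig χ (C, U))) ∂(Measure.pi fun _ : Fol L => haarProbability SU2) =
      ENNReal.ofReal (coneConst ^ (6 * L ^ 4 - 3) * t ^ (3 * (6 * L ^ 4 - 3))) *
        ∫⁻ y, {y : Fol L → ℍ | ∀ i, ‖dilateIm t (y i)‖ < 1}.indicator
          (fun y => G (fixHistory (ringConfig χ (C, fun i => quatToSU2 (dilateIm t (y i)))))) y ∂(Measure.pi fun _ : Fol L => (volume : Measure ℍ)) := by
  have hGC : Measurable fun U : Fol L → SU2 => G (fixHistory (ringConfig χ (C, U))) :=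
    hG.comp (measurable_fixHistory.comp ((measurable_ringConfig χ).comp (measurable_const.prodMk measurable_id)))
  rw [lintegral_haar_pi_eq_followerChart (fun _ : Fol L => (1 : ℍ)) (fun _ => norm_one) _ hGC ht, card_fol]
  simp only [one_mul]

/-! ## §3 The scaling identity for integrands -/

/-- The blow-up integrand `𝟙_{S_t} · G ∘ hist ∘ blowUpPoint t` is measurable. [folklore] -/
theorem measurable_blowUpIntegrand (χ : Site 3 L → SU2) {G : (Fin (2 * L - 1 + 1) → GaugeConfig 3 L SU2) × (Site 3 L → SU2) → ℝ≥0∞}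
    (hG : Measurable G) (t : ℝ) :
    Measurable fun x : ℍ × (((ℍ × ℍ) × ℍ) × (Fol L → ℍ)) =>
      {x' : ℍ × (((ℍ × ℍ) × ℍ) × (Fol L → ℍ)) | dil3 t x'.2.1 ∈ ball3 ∧ ∀ i, ‖dilateIm t (x'.2.2 i)‖ < 1}.indicator
        (fun x' => G (fixHistory (ringConfig χ (blowUpPoint t x')))) x := by
  have h1 : MeasurableSet {x : ℍ × (((ℍ × ℍ) × ℍ) × (Fol L → ℍ)) | dil3 t x.2.1 ∈ ball3} :=
    measurableSet_ball3.preimage ((measurable_dil3 t).comp (measurable_fst.comp measurable_snd))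
  have h2 : MeasurableSet {x : ℍ × (((ℍ × ℍ) × ℍ) × (Fol L → ℍ)) | ∀ i, ‖dilateIm t (x.2.2 i)‖ < 1} :=
    (measurableSet_followerBalls (L := L) t).preimage (measurable_snd.comp measurable_snd)
  have hS : MeasurableSet {x' : ℍ × (((ℍ × ℍ) × ℍ) × (Fol L → ℍ)) | dil3 t x'.2.1 ∈ ball3 ∧ ∀ i, ‖dilateIm t (x'.2.2 i)‖ < 1} :=
    (h1.inter h2).congr (by ext x; simp only [Set.mem_inter_iff, Set.mem_setOf_eq])
  exact (hG.comp (measurable_fixHistory.comp ((measurable_ringConfig χ).comp (measurable_blowUpPoint t)))).indicator hS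

/-- ★★★ **THE SCALING IDENTITY FOR INTEGRANDS, AT EVERY SCALE**: for central `χ`, a measurable `G ≥ 0` on ring histories invariant under a re-indexed seam
action (any `κ`) and every `t > 0`,
`∫⁻ G ∂μ_L = ofReal(coneConst^{6L⁴}·t^{18L⁴−2}) · ∫⁻ x, 𝟙{dil3 t w ∈ ball3 ∧ ∀ i, ‖dilateIm t (y i)‖ < 1}·G (fixHistory (ringConfig χ (blowUpPoint t x))) ∂β`,
`β = cone ⊗ (vol³ ⊗ vol^{Fol})` — tree gauge + ring chart (✓`lintegral_ringMeasure_eq_chart`), leader chart (✓`lintegral_haar_four_eq_leaderChart`, class function by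
`lintegral_pi_chart_conj`), follower chart (`lintegral_pi_chart_eq_followerChart`), Tonelli. [cite: tHooft1979] [cite: Luscher1983, §2] [cite: SeilerLNP1982, §2] -/
theorem lintegral_ringMeasure_eq_blowUp (κ : Site 3 L → Site 3 L) {χ : Site 3 L → SU2} (hχ : ∀ (x : Site 3 L) (k : SU2), k * χ x = χ x * k)
    {G : (Fin (2 * L - 1 + 1) → GaugeConfig 3 L SU2) × (Site 3 L → SU2) → ℝ≥0∞} (hG : Measurable G)
    (hinv : ∀ (h : Site 3 L → SU2) (p : (Fin (2 * L - 1 + 1) → GaugeConfig 3 L SU2) × (Site 3 L → SU2)),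
      G ((fun i => gaugeTransform h (p.1 i)), h * p.2 * (h ∘ κ)⁻¹) = G p)
    {t : ℝ} (ht : 0 < t) :
    ∫⁻ p, G p ∂(ringMeasure L) =
      ENNReal.ofReal (coneConst ^ (6 * L ^ 4) * t ^ (18 * L ^ 4 - 2)) *
        ∫⁻ x, {x' : ℍ × (((ℍ × ℍ) × ℍ) × (Fol L → ℍ)) | dil3 t x'.2.1 ∈ ball3 ∧ ∀ i, ‖dilateIm t (x'.2.2 i)‖ < 1}.indicator
            (fun x' => G (fixHistory (ringConfig χ (blowUpPoint t x')))) x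
          ∂(coneMeasure.prod ((volume : Measure ((ℍ × ℍ) × ℍ)).prod (Measure.pi fun _ : Fol L => (volume : Measure ℍ)))) := by
  haveI := isProbabilityMeasure_coneMeasure
  set vF : Measure (Fol L → ℍ) := Measure.pi fun _ : Fol L => (volume : Measure ℍ) with hvF
  haveI : SigmaFinite vF := by rw [hvF]; infer_instance
  set B : ℝ := coneConst ^ (6 * L ^ 4 - 3) * t ^ (3 * (6 * L ^ 4 - 3)) with hB
  -- the chart integrand and its follower integral
  have hHm : Measurable fun q : (Fin 4 → SU2) × (Fol L → SU2) => G (fixHistory (ringConfig χ q)) :=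
    hG.comp (measurable_fixHistory.comp (measurable_ringConfig χ))
  have hgm : Measurable fun C : Fin 4 → SU2 => ∫⁻ U, G (fixHistory (ringConfig χ (C, U))) ∂(Measure.pi fun _ : Fol L => haarProbability SU2) :=
    hHm.lintegral_prod_right'
  have hginv : ∀ (h : SU2) (C : Fin 4 → SU2),
      (∫⁻ U, G (fixHistory (ringConfig χ ((fun μ => h * C μ * h⁻¹), U))) ∂(Measure.pi fun _ : Fol L => haarProbability SU2)) =
        ∫⁻ U, G (fixHistory (ringConfig χ (C, U))) ∂(Measure.pi fun _ : Fol L => haarProbability SU2) :=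
    fun h C => lintegral_pi_chart_conj κ hχ hG hinv h C
  -- (1) ring chart + Tonelli on `Haar⁴ ⊗ Haar^{Fol}`; (2) leader chart
  have step1 : ∫⁻ p, G p ∂(ringMeasure L) =
      ∫⁻ C, (∫⁻ U, G (fixHistory (ringConfig χ (C, U))) ∂(Measure.pi fun _ : Fol L => haarProbability SU2))
        ∂(Measure.pi fun _ : Fin 4 => haarProbability SU2) := by
    rw [lintegral_ringMeasure_eq_chart κ χ hG hinv, lintegral_prod _ hHm.aemeasurable]
  rw [step1, lintegral_haar_four_eq_leaderChart _ hgm hginv ht]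
  -- (3) follower chart inside, read as the `(a, w)`-section of the blow-up integrand
  have hΦm := measurable_blowUpIntegrand (L := L) χ hG t
  have hsec : ∀ (a : ℍ) (w : (ℍ × ℍ) × ℍ),
      ball3.indicator (fun w' => ∫⁻ U, G (fixHistory (ringConfig χ (leaderTuple a w', U))) ∂(Measure.pi fun _ : Fol L => haarProbability SU2)) (dil3 t w) =
        ENNReal.ofReal B * ∫⁻ y, {x' : ℍ × (((ℍ × ℍ) × ℍ) × (Fol L → ℍ)) | dil3 t x'.2.1 ∈ ball3 ∧ ∀ i, ‖dilateIm t (x'.2.2 i)‖ < 1}.indicator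
          (fun x' => G (fixHistory (ringConfig χ (blowUpPoint t x')))) (a, (w, y)) ∂vF := by
    intro a w
    by_cases hb : dil3 t w ∈ ball3
    · rw [Set.indicator_of_mem hb]
      rw [lintegral_pi_chart_eq_followerChart χ hG (leaderTuple a (dil3 t w)) ht]
      congr 1
      refine lintegral_congr fun y => ?_
      by_cases hy : ∀ i, ‖dilateIm t (y i)‖ < 1
      · have hm1 : y ∈ {y : Fol L → ℍ | ∀ i, ‖dilateIm t (y i)‖ < 1} := hy
        have hm2 : ((a, (w, y)) : ℍ × (((ℍ × ℍ) × ℍ) × (Fol L → ℍ))) ∈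
            {x' : ℍ × (((ℍ × ℍ) × ℍ) × (Fol L → ℍ)) | dil3 t x'.2.1 ∈ ball3 ∧ ∀ i, ‖dilateIm t (x'.2.2 i)‖ < 1} := ⟨hb, hy⟩
        rw [Set.indicator_of_mem hm1, Set.indicator_of_mem hm2]
        rfl
      · have hm1 : y ∉ {y : Fol L → ℍ | ∀ i, ‖dilateIm t (y i)‖ < 1} := hy
        have hm2 : ((a, (w, y)) : ℍ × (((ℍ × ℍ) × ℍ) × (Fol L → ℍ))) ∉
            {x' : ℍ × (((ℍ × ℍ) × ℍ) × (Fol L → ℍ)) | dil3 t x'.2.1 ∈ ball3 ∧ ∀ i, ‖dilateIm t (x'.2.2 i)‖ < 1} := fun h => hy h.2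
        rw [Set.indicator_of_notMem hm1, Set.indicator_of_notMem hm2]
    · rw [Set.indicator_of_notMem hb]
      have he : ∀ y : Fol L → ℍ, {x' : ℍ × (((ℍ × ℍ) × ℍ) × (Fol L → ℍ)) | dil3 t x'.2.1 ∈ ball3 ∧ ∀ i, ‖dilateIm t (x'.2.2 i)‖ < 1}.indicator
          (fun x' => G (fixHistory (ringConfig χ (blowUpPoint t x')))) (a, (w, y)) = 0 := fun y => by
        have hm2 : ((a, (w, y)) : ℍ × (((ℍ × ℍ) × ℍ) × (Fol L → ℍ))) ∉
            {x' : ℍ × (((ℍ × ℍ) × ℍ) × (Fol L → ℍ)) | dil3 t x'.2.1 ∈ ball3 ∧ ∀ i, ‖dilateIm t (x'.2.2 i)‖ < 1} := fun h => hb h.1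
        exact Set.indicator_of_notMem hm2 _
      simp only [he, lintegral_zero, mul_zero]
  simp_rw [hsec]
  -- (4) Tonelli on `β`
  rw [lintegral_prod _ hΦm.aemeasurable]
  have hinner : ∀ a : ℍ, (∫⁻ m, {x' : ℍ × (((ℍ × ℍ) × ℍ) × (Fol L → ℍ)) | dil3 t x'.2.1 ∈ ball3 ∧ ∀ i, ‖dilateIm t (x'.2.2 i)‖ < 1}.indicator
      (fun x' => G (fixHistory (ringConfig χ (blowUpPoint t x')))) (a, m) ∂((volume : Measure ((ℍ × ℍ) × ℍ)).prod vF)) =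
      ∫⁻ w, ∫⁻ y, {x' : ℍ × (((ℍ × ℍ) × ℍ) × (Fol L → ℍ)) | dil3 t x'.2.1 ∈ ball3 ∧ ∀ i, ‖dilateIm t (x'.2.2 i)‖ < 1}.indicator
        (fun x' => G (fixHistory (ringConfig χ (blowUpPoint t x')))) (a, (w, y)) ∂vF ∂(volume : Measure ((ℍ × ℍ) × ℍ)) := fun a =>
    lintegral_prod _ (hΦm.comp (measurable_const.prodMk measurable_id)).aemeasurable
  simp_rw [hinner]
  have hBtop : ENNReal.ofReal B ≠ ∞ := ENNReal.ofReal_ne_top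
  simp_rw [lintegral_const_mul' _ _ hBtop]
  rw [← mul_assoc]
  congr 1
  have hc0 : 0 ≤ coneConst := by rw [coneConst]; exact ENNReal.toReal_nonneg
  rw [← ENNReal.ofReal_mul (by positivity), hB]
  congr 1
  obtain ⟨h1, h2⟩ := jacobian_exponents (L := L)
  calc coneConst ^ 3 * t ^ 7 * (coneConst ^ (6 * L ^ 4 - 3) * t ^ (3 * (6 * L ^ 4 - 3)))
      = coneConst ^ (3 + (6 * L ^ 4 - 3)) * t ^ (7 + 3 * (6 * L ^ 4 - 3)) := by rw [pow_add, pow_add]; ring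
    _ = coneConst ^ (6 * L ^ 4) * t ^ (18 * L ^ 4 - 2) := by rw [h1, h2]

end Summit.QuantumFields.YangMills.Theorems.SwapVirialDeficit.BlowUpRing

end
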